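import Mathlib
import Literature.MathematicalPhysics.QuantumFieldTheory.Balaban1983to89.Beta.OneLoop
import Literature.MathematicalPhysics.QuantumFieldTheory.Balaban1983to89.Beta.Composition

/-!
# `Balaban1983to89.Beta.CompositionOneLoop` — the composition law of `Beta.Composition` instantiated on the Stage-0
structure `Beta.ConstrainedGaussian` of `Beta/OneLoop.lean` (BETA sub-cell, kernel node BETA-COMP-KERNEL, bridge file)

HONEST FRAMING (BETA-SPEC.md, verbatim): discharging `BetaPertH` makes Bałaban's UV stability UNCONDITIONAL — a real
constructive-QFT result; it is NOT the continuum limit and NOT the Clay problem.  This file discharges NOTHING of the β series;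
it is glue between two landed kernel files so that the rows an1 / an2 / num can use the composition law BY NAME on the object
they already work with.  Value = kernel identity, NOT summit progress.

CITATION HEADER.  T. Bałaban, *Comm. Math. Phys.* **109** (1987) 249–301 [Balaban1987RG1] (cell paper B12), p. 260 (1.3)–(1.4)
(render `HOME/b2b-balaban-ref1/pages/1987-cmp109-rg-I-small-field/…-p012-x2.png`, read as an image; quoted in full in the
module docstrings of `Beta/OneLoop.lean` and `Beta/Composition.lean`): the order-0 part of the k-th action is
"Σ_{j=0}^{k−1} … [log Z^{(j)}(U_k) − log Z^{(j)}(1)] …" with "Z^{(j)}(U_k) = ∫ dB δ(Q̃B) exp[−½⟨B, Δ^{(j)}(U_k) B⟩].  (1.4)".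
Nothing of the paper is restated as a fact (D-0026: no `def … : Prop` here).

WHAT IS PROVED (all [folklore], finite-dimensional, over `ℝ`):
* `ConstrainedGaussian.kkt_eq_comp`, `ConstrainedGaussian.logZ_eq_comp`: the Stage-0 bordered matrix / closed-form `logZ` of a
  datum `Z = (Q, Δ)` ARE `Composition.kkt Z.Δ Z.Q` / `Composition.logZ Z.Δ Z.Q` (definitional up to `Fintype.card_fin`).
* `ConstrainedGaussian.comp Z G Q₂ := (Q₂ Q, Δ + Qᵀ G Q)` (the one-shot two-step datum) and
  `ConstrainedGaussian.blockStep Z G Q₂ := (Q₂, P⁻¹ + G)`, `P = Q Δ⁻¹ Qᵀ` (the block-level datum of the second step);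
  `ConstrainedGaussian.logZ_comp`: `(Z.comp G Q₂).logZ = Z.logZ + (Z.blockStep G Q₂).logZ` under the three invertibility
  hypotheses of `Composition.logZ_compForm` plus that of the second block propagator.
* `Composition.Chain.stepDatum`, `Composition.Chain.totalDatum` for a chain with levels `Fin (d j)`, and
  `Composition.Chain.logZ_totalDatum`: `(c.totalDatum k).logZ = Σ_{j ≤ k} (c.stepDatum j).logZ` — the k-fold law
  `Chain.logZ_total` read on Stage-0 data: the finite-dimensional shape of the SUM in (1.3).
HYPOTHESES vs `ConstrainedGaussian.Regular`: the composition theorems ask `IsUnit Δ.det` (and units for the block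
propagators and the composite form), which is STRONGER than `Regular` (there `Δ` need only be positive on `ker Q`); the
singular-`Δ` case is not covered here (it needs the reduced form `logZred` of `Beta/ConstraintElimination.lean`; not attempted).
The identification of any of these matrices with Bałaban's operators is the READING DIVERGENCE D-pv28.1 / open point GAPS G-pv28-1,
not a statement of this file.
-/

noncomputable section

namespace Literature.MathematicalPhysics.QuantumFieldTheory.Balaban1983to89.Beta

open scoped Matrix BigOperators

namespace ConstrainedGaussian

variable {n m p : ℕ}

/-- Bridge: the Stage-0 bordered matrix of `Z = (Q, Δ)` is `Composition.kkt Z.Δ Z.Q` (same block convention). [folklore] -/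
theorem kkt_eq_comp (Z : ConstrainedGaussian n m) : Z.kkt = Composition.kkt Z.Δ Z.Q := rfl

/-- Bridge: the Stage-0 closed-form `logZ` of `Z` is `Composition.logZ Z.Δ Z.Q`. [folklore] -/
theorem logZ_eq_comp (Z : ConstrainedGaussian n m) : Z.logZ = Composition.logZ Z.Δ Z.Q := by
  simp only [logZ, Composition.logZ, kkt_eq_comp, Fintype.card_fin]

/-- The one-shot two-step datum: constraint `Q₂ Q` (compose the two averaging maps), form `Δ + Qᵀ G Q` (add the second
step's block-level form pulled back along `Q`). [folklore] -/
def comp (Z : ConstrainedGaussian n m) (G : Matrix (Fin m) (Fin m) ℝ) (Q₂ : Matrix (Fin p) (Fin m) ℝ) :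
    ConstrainedGaussian n p :=
  ⟨Q₂ * Z.Q, Composition.compForm Z.Δ Z.Q G⟩

/-- The block-level datum of the second step: constraint `Q₂`, form `P⁻¹ + G` with `P = Q Δ⁻¹ Qᵀ` the block propagator of
the first step. [folklore] -/
def blockStep (Z : ConstrainedGaussian n m) (G : Matrix (Fin m) (Fin m) ℝ) (Q₂ : Matrix (Fin p) (Fin m) ℝ) :
    ConstrainedGaussian m p :=
  ⟨Q₂, (Composition.blockProp Z.Δ Z.Q)⁻¹ + G⟩

/-- Unfolding: the constraint of the composite datum. [folklore] -/
theorem comp_Q (Z : ConstrainedGaussian n m) (G : Matrix (Fin m) (Fin m) ℝ) (Q₂ : Matrix (Fin p) (Fin m) ℝ) :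
    (Z.comp G Q₂).Q = Q₂ * Z.Q := rfl

/-- Unfolding: the form of the composite datum. [folklore] -/
theorem comp_Δ (Z : ConstrainedGaussian n m) (G : Matrix (Fin m) (Fin m) ℝ) (Q₂ : Matrix (Fin p) (Fin m) ℝ) :
    (Z.comp G Q₂).Δ = Z.Δ + Z.Qᵀ * G * Z.Q := rfl

/-- Unfolding: the constraint of the block-level datum. [folklore] -/
theorem blockStep_Q (Z : ConstrainedGaussian n m) (G : Matrix (Fin m) (Fin m) ℝ) (Q₂ : Matrix (Fin p) (Fin m) ℝ) :
    (Z.blockStep G Q₂).Q = Q₂ := rfl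

/-- Unfolding: the form of the block-level datum. [folklore] -/
theorem blockStep_Δ (Z : ConstrainedGaussian n m) (G : Matrix (Fin m) (Fin m) ℝ) (Q₂ : Matrix (Fin p) (Fin m) ℝ) :
    (Z.blockStep G Q₂).Δ = (Z.Q * Z.Δ⁻¹ * Z.Qᵀ)⁻¹ + G := rfl

/-- THE COMPOSITION LAW on Stage-0 data: `logZ (Q₂Q, Δ + QᵀGQ) = logZ (Q, Δ) + logZ (Q₂, P⁻¹ + G)` — two successive constrained
Gaussian log-normalisations add up to the one-shot one — for `Δ`, `P = QΔ⁻¹Qᵀ`, `Δ + QᵀGQ` and the second block propagator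
`Q₂ (P⁻¹ + G)⁻¹ Q₂ᵀ` invertible (`Composition.logZ_compForm`). [folklore] -/
theorem logZ_comp (Z : ConstrainedGaussian n m) (G : Matrix (Fin m) (Fin m) ℝ) (Q₂ : Matrix (Fin p) (Fin m) ℝ)
    (hH : IsUnit Z.Δ.det) (hP : IsUnit (Composition.blockProp Z.Δ Z.Q).det)
    (hT : IsUnit (Composition.compForm Z.Δ Z.Q G).det)
    (hB : IsUnit (Composition.blockProp ((Composition.blockProp Z.Δ Z.Q)⁻¹ + G) Q₂).det) :
    (Z.comp G Q₂).logZ = Z.logZ + (Z.blockStep G Q₂).logZ := by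
  simp only [logZ_eq_comp]
  exact Composition.logZ_compForm Z.Δ Z.Q G Q₂ hH hP hT hB

/-- The determinant form of the same law: `det kkt (comp) = (−1)^m · det kkt Z · det kkt (blockStep)`
(`Composition.det_kkt_compForm`). [folklore] -/
theorem det_kkt_comp (Z : ConstrainedGaussian n m) (G : Matrix (Fin m) (Fin m) ℝ) (Q₂ : Matrix (Fin p) (Fin m) ℝ)
    (hH : IsUnit Z.Δ.det) (hP : IsUnit (Composition.blockProp Z.Δ Z.Q).det)
    (hT : IsUnit (Composition.compForm Z.Δ Z.Q G).det) :
    (Z.comp G Q₂).kkt.det = (-1) ^ m * (Z.kkt.det * (Z.blockStep G Q₂).kkt.det) := by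
  have h := Composition.det_kkt_compForm Z.Δ Z.Q G Q₂ hH hP hT
  rw [Fintype.card_fin] at h
  exact h

end ConstrainedGaussian

namespace Composition.Chain

variable {d : ℕ → ℕ} (c : Composition.Chain ℝ (fun j => Fin (d j)))

/-- The Stage-0 datum of the j-th step of a chain with levels `Fin (d j)`: constraint `Q j`, form `E j + G j`. [folklore] -/
def stepDatum (j : ℕ) : ConstrainedGaussian (d j) (d (j + 1)) :=
  ⟨c.Q j, c.stepForm j⟩

/-- The Stage-0 datum of the one-shot (k+1)-fold integration: constraint `Q^{(k+1)} = Q k ⋯ Q 0`, form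
`T (k+1) = H0 + Σ_{j ≤ k} (Q^{(j)})ᵀ (G j) Q^{(j)}`. [folklore] -/
def totalDatum (k : ℕ) : ConstrainedGaussian (d 0) (d (k + 1)) :=
  ⟨c.compQ (k + 1), c.total (k + 1)⟩

/-- THE k-FOLD LAW on Stage-0 data: `logZ (totalDatum k) = Σ_{j ≤ k} logZ (stepDatum j)` whenever every step form `E j + G j`
and every step block propagator is invertible (`Composition.Chain.logZ_total`) — the finite-dimensional shape of the sum
`Σ_{j=0}^{k−1} log Z^{(j)}` in (1.3). [folklore] -/
theorem logZ_totalDatum (k : ℕ) (hS : ∀ j ≤ k, IsUnit (c.stepForm j).det)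
    (hP : ∀ j ≤ k, IsUnit (Composition.blockProp (c.stepForm j) (c.Q j)).det) :
    (c.totalDatum k).logZ = ∑ j ∈ Finset.range (k + 1), (c.stepDatum j).logZ := by
  simp only [ConstrainedGaussian.logZ_eq_comp]
  exact Composition.Chain.logZ_total c k hS hP

end Composition.Chain

end Literature.MathematicalPhysics.QuantumFieldTheory.Balaban1983to89.Beta

end
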